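import Literature.AlgebraicGeometry.Frobenioids.MonoidFunctors
import Literature.AlgebraicGeometry.Frobenioids.ModelFrobenioid
import HarnessLib

/-!
# Frobenioids I: bridge between the two renderings of `Φ^gp` (Def. 1.1 (ii))

Mochizuki, *The geometry of Frobenioids I*, Def. 1.1 (ii), kurims p. 19: the groupification `Φ^gp`
of a monoid `Φ` on `D` [cite: MochizukiFrdI2008, Def. 1.1(ii) p.19].  Two files of this directory
introduced it independently on 2026-08-25: `MonoidFunctors.lean` (`gpMap`, `groupificationFunctor`,
the CANONICAL names per the L1 lead's ruling I2′) and `ModelFrobenioid.lean` (`MonGp.map`,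
`MonGp.functor`, `monoidGp Φ := Φ ⋙ MonGp.functor`, used by the model Frobenioid of Thm. 5.2 (i)).
This file records that the two agree *definitionally*, so every statement about
`ModelFrobenioid Φ B DivB` (with `DivB : B ⟶ monoidGp Φ`) may be fed a `DivB : B ⟶ groupificationFunctor Φ`
and conversely.  New code should use `groupificationFunctor`.
-/

namespace Literature.AlgebraicGeometry.Frobenioids

open CategoryTheory

universe w v u

/-- `MonGp.map` (ModelFrobenioid.lean) is `gpMap` (MonoidFunctors.lean), definitionally.
[cite: MochizukiFrdI2008, Def. 1.1(ii) p.19] -/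
theorem MonGp.map_eq_gpMap {M N : Type w} [CommMonoid M] [CommMonoid N] (f : M →* N) :
    MonGp.map f = gpMap f := rfl

/-- `monoidGp Φ = Φ ⋙ MonGp.functor` (ModelFrobenioid.lean) is `groupificationFunctor Φ`
(MonoidFunctors.lean), definitionally. [cite: MochizukiFrdI2008, Def. 1.1(ii) p.19] -/
theorem monoidGp_eq_groupificationFunctor {D : Type u} [Category.{v} D] (Φ : Dᵒᵖ ⥤ CommMonCat.{w}) :
    monoidGp Φ = groupificationFunctor Φ := rfl

/-- Consequently the model Frobenioid may be formed from `Div_B : B → Φ^gp` given with the canonical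
`groupificationFunctor`: the type of such `Div_B` is the type expected by `ModelFrobenioid`.
[cite: MochizukiFrdI2008, Thm. 5.2 p.100] -/
theorem divB_type_eq {D : Type u} [Category.{v} D] (Φ B : Dᵒᵖ ⥤ CommMonCat.{w}) :
    (B ⟶ groupificationFunctor Φ) = (B ⟶ monoidGp Φ) := rfl

end Literature.AlgebraicGeometry.Frobenioids
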